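import Literature.AnabelianGeometry.EtaleTheta.Discharge.Sec1Rmk164ThetaLevelCompletion
import Literature.AnabelianGeometry.EtaleTheta.ThetaSettingHatTheta
import Literature.AnabelianGeometry.EtaleTheta.ContH1ActionCongr
import HarnessLib

/-!
# [EtTh] Remark 1.6.4 at the profinite Θ-quotient record `ThetaSetting.HatTheta`: the «ιYdd» input and
# the uniqueness of the profinite theta classes — proof-only instance file

Mochizuki, *The étale theta function and its Frobenioid-theoretic manifestations*, Publ. RIMS **45**
(2009) [EtTh], Remark 1.6.4 p. 252 ("determines, by profinite completion, a set of classes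
`O^×_K̈ · (η̈^Θ)^∧ ∈ H¹(Π_{Ÿ^∧}, Δ_Θ)`") [cite: MochizukiEtTh2009, Rmk 1.6.4 p.252], via the Θ-quotient (Prop. 1.5
(iii) p. 23) — abc-iut spec of record «RMK164-PROFINITE-TWIN v2» (L2-lead R1227).

PROOF-ONLY (abc-iut cell, prover abc-iut-f-128 gen 8, row «RMK164-IOTA-YDD-THETA» file 2b = the instance of
file 2/2 `Discharge/Sec1Rmk164ThetaLevelCompletion.lean` at abc-iut-f-142's record
`ThetaSetting.HatTheta` (`ThetaSettingHatTheta.lean`: `GhatTheta`, `toThetaHat`, `ι`, `ι_toTheta`,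
`isProfiniteCompletion_ι`, `ι_injective`, `GtpYddTheta`, `GhatThetaYdd`, `ιYdd`, `DeltaThetaHat`, `H1ThetaHat`,
`H1Hat`, `GtpYddHat`); no definitions, no facts):
* `HatTheta.isProfiniteCompletion_ιYdd_of_isCompact` — the spec's ONE displayed input
  «`IsProfiniteCompletion ιYdd`» holds as soon as `(Π^tp_Ÿ)^Θ` has compact carrier (injectivity of `ι` is the
  record's theorem `ι_injective`; NO cofinality clause; `IsProfiniteCompletion.restrict_of_isCompact`);
* `HatTheta.existsUnique_comap_eq_of_isCompact` — then every class of `H¹((Π^tp_Ÿ)^Θ, ι(Δ_Θ))` (action through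
  `ι`) is the pull-back of a UNIQUE class of `H¹(((Π^tp_Ÿ)^Θ)^∧, ι(Δ_Θ))` (abc-iut p503502
  `ContH1.comap_bijective_of_isProfiniteCompletion`);
* `HatTheta.comap_toHat_injective_gtpYddHat` / `eq_of_comap_toHat_eq` — a class of `H¹(Π_{Ÿ^∧}, Δ_Θ)`
  (`T.H1Hat D.GtpYddHat`) is determined by its pull-back to `Π^tp_Ÿ` (no hypothesis: `toHat(Π^tp_Ÿ)` is dense in
  `Π_{Ÿ^∧}` by definition of the latter as a closure — reading (a) of record).
The compactness of `(Π^tp_Ÿ)^Θ` is DISPLAYED (a property of genuine §1 data: `(Δ^tp_Ÿ)^Θ` is an extension of the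
profinite `(Δ^tp_Ÿ)^ell` by `Δ_Θ ≅ Ẑ(1)`), asserted for no datum.  Nothing here bears on [IUTchIII] Cor. 3.12;
typed ≠ proved.
-/

noncomputable section

namespace Literature.AnabelianGeometry.EtaleTheta

open scoped IsMulCommutative
open Topology
open Literature.AnabelianGeometry.SemiGraphs

namespace ThetaSetting

namespace HatTheta

variable {p : ℕ} [Fact p.Prime] {D : ThetaSetting p} (T : D.HatTheta)

/-- **The «ιYdd» input of the RMK164 spec at the record.**  If `(Π^tp_Ÿ)^Θ = toTheta(Π^tp_Ÿ)` has compact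
carrier, then `ιYdd : (Π^tp_Ÿ)^Θ → ((Π^tp_Ÿ)^Θ)^∧ := closure ι((Π^tp_Ÿ)^Θ)` IS a profinite completion — `ι` is
injective (`ι_injective`), the target is Hausdorff totally disconnected inside the profinite `((Π^tp_X)^Θ)^∧`; no
cofinality clause. [cite: MochizukiEtTh2009, Rmk 1.6.4 p.252] -/
theorem isProfiniteCompletion_ιYdd_of_isCompact
    (hK : IsCompact ((D.GtpYddTheta : Subgroup D.GtpTheta) : Set D.GtpTheta)) :
    IsProfiniteCompletion T.ιYdd :=
  IsProfiniteCompletion.restrict_of_isCompact T.ι D.GtpYddTheta hK (T.ι_injective.injOn) T.GhatThetaYdd rfl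
    T.ιYdd T.ιYdd_apply

/-- **Θ-level «determines, by profinite completion» at the record (existence and uniqueness).**  With
`(Π^tp_Ÿ)^Θ` compact, every continuous class `y ∈ H¹((Π^tp_Ÿ)^Θ, ι(Δ_Θ))` (action through `ι`) is the pull-back
along `ι` of a UNIQUE class `ŷ ∈ H¹(((Π^tp_Ÿ)^Θ)^∧, ι(Δ_Θ)) = T.H1ThetaHat T.GhatThetaYdd`.
[cite: MochizukiEtTh2009, Rmk 1.6.4 p.252] [cite: NeukirchSchmidtWingberg2008, I §2 and II §7] -/
theorem existsUnique_comap_eq_of_isCompact [T.DeltaThetaHat.Normal]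
    (hK : IsCompact ((D.GtpYddTheta : Subgroup D.GtpTheta) : Set D.GtpTheta))
    (y : ContH1 ((MonoidHom.id T.GhatTheta).comp T.ι.toMonoidHom) T.DeltaThetaHat D.GtpYddTheta) :
    ∃! yh : T.H1ThetaHat T.GhatThetaYdd,
      ContH1.comap (MonoidHom.id T.GhatTheta) T.DeltaThetaHat T.ι.toMonoidHom T.ι.continuous
        T.map_ι_gtpYddTheta_le_ghatThetaYdd yh = y :=
  (ContH1.comap_bijective_of_isProfiniteCompletion (φ := MonoidHom.id T.GhatTheta) continuous_id
    T.isClosed_deltaThetaHat T.ι.continuous T.map_ι_gtpYddTheta_le_ghatThetaYdd T.ιYdd_apply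
    (T.isProfiniteCompletion_ιYdd_of_isCompact hK)).existsUnique y

/-- The bijection form: pull-back along `ι` is a bijection
`H¹(((Π^tp_Ÿ)^Θ)^∧, ι(Δ_Θ)) → H¹((Π^tp_Ÿ)^Θ, ι(Δ_Θ))` when `(Π^tp_Ÿ)^Θ` is compact.
[cite: MochizukiEtTh2009, Rmk 1.6.4 p.252] -/
theorem comap_ι_bijective_of_isCompact [T.DeltaThetaHat.Normal]
    (hK : IsCompact ((D.GtpYddTheta : Subgroup D.GtpTheta) : Set D.GtpTheta)) :
    Function.Bijective (ContH1.comap (MonoidHom.id T.GhatTheta) T.DeltaThetaHat T.ι.toMonoidHom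
      T.ι.continuous T.map_ι_gtpYddTheta_le_ghatThetaYdd :
        T.H1ThetaHat T.GhatThetaYdd →
          ContH1 ((MonoidHom.id T.GhatTheta).comp T.ι.toMonoidHom) T.DeltaThetaHat D.GtpYddTheta) :=
  ContH1.comap_bijective_of_isProfiniteCompletion (φ := MonoidHom.id T.GhatTheta) continuous_id
    T.isClosed_deltaThetaHat T.ι.continuous T.map_ι_gtpYddTheta_le_ghatThetaYdd T.ιYdd_apply
    (T.isProfiniteCompletion_ιYdd_of_isCompact hK)

/-- **A class of `H¹(Π_{Ÿ^∧}, Δ_Θ)` is determined by its pull-back to `Π^tp_Ÿ`** (at the record, NO hypothesis):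
the pull-back `T.H1Hat D.GtpYddHat → H¹(Π^tp_Ÿ, ι(Δ_Θ))` along `toHat` is injective, `Π_{Ÿ^∧}` being the closure
of `toHat(Π^tp_Ÿ)` (reading (a) of record).  So the profinite theta class `(η̈^Θ)^∧` is UNIQUE among classes
restricting to `η̈^Θ`. [cite: MochizukiEtTh2009, Rmk 1.6.4 p.252] -/
theorem comap_toHat_injective_gtpYddHat [T.DeltaThetaHat.Normal] :
    Function.Injective (ContH1.comap T.toThetaHat.toMonoidHom T.DeltaThetaHat D.toHat.toMonoidHom
      D.toHat.continuous D.map_toHat_gtpYdd_le_gtpYddHat :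
        T.H1Hat D.GtpYddHat →
          ContH1 (T.toThetaHat.toMonoidHom.comp D.toHat.toMonoidHom) T.DeltaThetaHat D.GtpYdd) :=
  D.comap_toHat_injective_PiYddHat T.toThetaHat.toMonoidHom T.toThetaHat.continuous T.DeltaThetaHat

/-- Spelled out: two classes of `H¹(Π_{Ÿ^∧}, Δ_Θ)` with the same restriction to `Π^tp_Ÿ` are equal.
[cite: MochizukiEtTh2009, Rmk 1.6.4 p.252] -/
theorem eq_of_comap_toHat_eq [T.DeltaThetaHat.Normal] (x x' : T.H1Hat D.GtpYddHat)
    (h : ContH1.comap T.toThetaHat.toMonoidHom T.DeltaThetaHat D.toHat.toMonoidHom D.toHat.continuous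
        D.map_toHat_gtpYdd_le_gtpYddHat x =
      ContH1.comap T.toThetaHat.toMonoidHom T.DeltaThetaHat D.toHat.toMonoidHom D.toHat.continuous
        D.map_toHat_gtpYdd_le_gtpYddHat x') :
    x = x' :=
  T.comap_toHat_injective_gtpYddHat h

/-! ### The functoriality square: pulling the inflated profinite class back to `Π^tp_Ÿ` -/

/-- The two action homomorphisms `Π^tp_X → ((Π^tp_X)^Θ)^∧` — through `Π_X` (`toThetaHat ∘ toHat`) and through
`(Π^tp_X)^Θ` (`ι ∘ toTheta`) — agree (the record's square `ι_toTheta`), so they induce the same conjugation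
action on `ι(Δ_Θ)`. [cite: MochizukiEtTh2009, §1 p.12] -/
theorem conjNormal_toThetaHat_toHat_eq [T.DeltaThetaHat.Normal] (g : D.PiTemp) (_hg : g ∈ D.GtpYdd)
    (a : T.DeltaThetaHat) :
    MulAut.conjNormal ((T.toThetaHat.toMonoidHom.comp D.toHat.toMonoidHom) g) a =
      MulAut.conjNormal ((((MonoidHom.id T.GhatTheta).comp T.ι.toMonoidHom).comp D.toTheta) g) a := by
  have h : (T.toThetaHat.toMonoidHom.comp D.toHat.toMonoidHom) g =
      (((MonoidHom.id T.GhatTheta).comp T.ι.toMonoidHom).comp D.toTheta) g := (T.ι_toTheta g).symm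
  rw [h]

/-- **«By functoriality»** (spec v2, D3): for a class `ẑ ∈ H¹(((Π^tp_Ÿ)^Θ)^∧, ι(Δ_Θ))`, the profinite class
`inflThetaHat ẑ ∈ H¹(Π_{Ÿ^∧}, Δ_Θ)` pulled back to `Π^tp_Ÿ` along `toHat` IS the pull-back along
`toTheta : Π^tp_Ÿ → (Π^tp_Ÿ)^Θ` of the Θ-level pull-back `ι^* ẑ` — up to the (identity-on-cocycles) transport
`ContH1.actionCongr` between the two equal actions `toThetaHat ∘ toHat = ι ∘ toTheta`.  Hence, when
`ι^* ẑ = x^Θ` is the Θ-level avatar of a tempered theta class `x = inflTheta x^Θ`, the profinite class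
`(x)^∧ := inflThetaHat ẑ` restricts to `x`: this is the kernel content of "determines, by profinite completion".
[cite: MochizukiEtTh2009, Rmk 1.6.4 p.252] [cite: NeukirchSchmidtWingberg2008, I §2 and II §7] -/
theorem actionCongr_comap_toHat_inflThetaHat [T.DeltaThetaHat.Normal] (z : T.H1ThetaHat T.GhatThetaYdd) :
    ContH1.actionCongr (H := D.GtpYdd) (T.conjNormal_toThetaHat_toHat_eq)
      (ContH1.comap T.toThetaHat.toMonoidHom T.DeltaThetaHat D.toHat.toMonoidHom D.toHat.continuous
        D.map_toHat_gtpYdd_le_gtpYddHat (T.inflThetaHat z)) =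
    ContH1.comap ((MonoidHom.id T.GhatTheta).comp T.ι.toMonoidHom) T.DeltaThetaHat D.toTheta
      D.continuous_toTheta (le_refl (D.GtpYdd.map D.toTheta))
      (ContH1.comap (MonoidHom.id T.GhatTheta) T.DeltaThetaHat T.ι.toMonoidHom T.ι.continuous
        T.map_ι_gtpYddTheta_le_ghatThetaYdd z) := by
  induction z using QuotientGroup.induction_on with
  | H f =>
    apply congrArg (QuotientGroup.mk
      (s := (contCoboundaries (((MonoidHom.id T.GhatTheta).comp T.ι.toMonoidHom).comp D.toTheta)
        T.DeltaThetaHat D.GtpYdd).subgroupOf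
          (contCocycles (((MonoidHom.id T.GhatTheta).comp T.ι.toMonoidHom).comp D.toTheta)
            T.DeltaThetaHat D.GtpYdd)))
    apply Subtype.ext
    funext y
    exact congrArg f.1 (Subtype.ext (T.ι_toTheta y.1).symm)

end HatTheta

end ThetaSetting

end Literature.AnabelianGeometry.EtaleTheta

end
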